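import Literature.Geometry.Kaehler.HolomorphicLineBundle
import Literature.Geometry.Kaehler.CechDolbeault
import Literature.Algebra.Homology.CechTupleFaces
import HarnessLib

/-!
# The Čech complex of the sheaf of sections of a cocycle line bundle

Layer `Literature/Geometry/Kaehler`, companion of `HolomorphicLineBundle` (holomorphic line bundles on
a complex manifold `M` presented by a Čech cocycle `g_ij` on a trivialising cover `U_i`, Voisin I,
§3.3.1 and Thm. 4.49; the coordinate of a section in the frame `σ_j` is `g_ij` times its coordinate
in the frame `σ_i`). For the sheaf `𝒪(L)` of holomorphic sections of `L` (Voisin I, proof of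
Thm. 4.49: `𝓛_β(V) = {(f_i) | f_i ∈ 𝒪(V ∩ U_i), f_j = β_ij f_i}`) and an open cover
`𝔙 = (V_k)_{k ∈ κ}` of (part of) `M` which is SUBORDINATE to the trivialisation through a frame map
`k ↦ frame k` (`V_k ⊆ U_{frame k}`), a section of `L` over `V_J = V_{k₀} ∩ ⋯ ∩ V_{k_a}` is ONE
holomorphic function, its coordinate in the frame `σ_{frame k₀}` of the FIRST index; this file builds
the full ordered Čech complex `C^•(𝔙, 𝒪(L))` in that presentation (J.-P. Serre, FAC n° 18;
R. Godement, *Théorie des faisceaux* (1958), II.5.1; Bott–Tu §8 for the tuple combinatorics, exactly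
as the tree's scalar `CechDeRham` / `CechDolbeault`):

* `holFunOn E W` — the holomorphic functions on `W ⊆ M`, extended by zero (a `ℂ`-submodule of
  `M → ℂ`; the scalar sections `𝒪(W)`), and `holFunOn.mulRestrict` — "multiply by a function
  holomorphic on `W' ⊆ W` and restrict to `W'`", the shape of all restriction maps of `𝒪(L)`;
* `HolomorphicLineBundle.FramedCover L κ` — an open family `V : κ → Set M` with frames
  `frame : κ → ι`, `V_k ⊆ U_{frame k}`; `FramedCover.Cochain C a = Π_{J : Fin (a+1) → κ} 𝒪(V_J)`;
* `FramedCover.trans C J τ = g_{frame (J (τ 0)), frame (J 0)}` — the change of frame along a map of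
  tuples `τ` (first index of the face ↦ first index of `J`), multiplicative in `τ`
  (`trans_mul_trans`, the cocycle condition) — and the restriction maps
  `FramedCover.face C J τ : 𝒪(L)(V_{J ∘ τ}) → 𝒪(L)(V_J)`, FUNCTORIAL in `τ` (`face_face`): the
  sections of `L` over the finite intersections form a presheaf on the nerve;
* `FramedCover.delta C a` — the Čech differential `(δ c)_J = Σ_j (-1)^j c_{J ∘ σ_j}|_{V_J}`
  (restriction of `𝒪(L)`, i.e. with the change of frame on the `0`-th face), with
  **`delta_delta : δ ∘ δ = 0`** (functoriality + the tree's cancellation in pairs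
  `CechTuple.sum_sum_neg_one_pow_smul_smul_faces_eq_zero`);
* `FramedCover.cohomology C q = Ȟ^q(𝔙, 𝒪(L))` in the tree's concrete format
  `NatCochain.Cohomology`, so that the abstract finiteness theorem
  `Module.finite_of_compact_restriction` and the double-complex comparison theorems apply verbatim;
* `FramedCover.delta_zero_eq_zero_iff` — a `0`-cochain is a cocycle iff its components glue
  (`c_l = g_{frame k, frame l} c_k` on `V_k ∩ V_l`), i.e. `Ȟ⁰(𝔙, 𝒪(L)) = Γ(⋃ V_k, L)`;
* `FramedCover.shrink`, `FramedCover.res` — shrinking the cover on the same index set (the nested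
  covers `𝔙'' ≪ 𝔙' ≪ 𝔙` of the Cartan–Serre finiteness theorem) and the restriction of cochains, a
  cochain map (`res_delta`).

Everything is proved; the definitions are the carriers and maps just listed.

## What is NOT here

The comparison `Ȟ⁰ ≅ Γ(M, L)` with the section space of `HolomorphicLineBundleSectionsFinite` and
the finiteness of `Ȟ¹` (twisted Cartan–Serre), which use this file; refinement maps between covers
with different index sets; the sheaf property beyond degree `0`.

## References

* J.-P. Serre, *Faisceaux algébriques cohérents*, Ann. of Math. 61 (1955), n° 18 (Čech complex of a
  cover with coefficients in a sheaf). [SerreFAC1955]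
* C. Voisin, *Hodge Theory and Complex Algebraic Geometry I* (2002), §3.3.1, Thm. 4.49 (proof),
  §4.3.1. [VoisinHodgeI2002]
* R. Bott, L. W. Tu, *Differential Forms in Algebraic Topology* (1982), §8 (8.1)–(8.4).
  [BottTu1982Forms]
-/

noncomputable section

open scoped Manifold ContDiff Topology
open Set Filter Function Literature.Algebra.Homology

namespace Literature.Geometry.Kaehler

variable {ι κ : Type*} {E : Type*} [NormedAddCommGroup E] [NormedSpace ℂ E]
  {M : Type*} [TopologicalSpace M] [ChartedSpace E M]

/-! ### Holomorphic functions on a subset, extended by zero -/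

variable (E) in
/-- **`𝒪(W)`, the holomorphic functions on `W ⊆ M` extended by zero**: functions `M → ℂ`
holomorphic on `W` (Mathlib's `MDifferentiableOn 𝓘(ℂ, E) 𝓘(ℂ, ℂ)`) and vanishing off `W`, a
`ℂ`-submodule of `M → ℂ` (the normalisation by zero makes a section over `W` a unique function, as
`smoothFormsOn` / `pqFormsOn` do for forms). [cite: VoisinHodgeI2002, §2.2.1] -/
def holFunOn (W : Set M) : Submodule ℂ (M → ℂ) where
  carrier := {f | MDifferentiableOn 𝓘(ℂ, E) 𝓘(ℂ, ℂ) f W ∧ ∀ x ∉ W, f x = 0}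
  add_mem' hf hg := ⟨hf.1.add hg.1, fun x hx ↦ by rw [Pi.add_apply, hf.2 x hx, hg.2 x hx, add_zero]⟩
  zero_mem' := ⟨mdifferentiableOn_const, fun _ _ ↦ rfl⟩
  smul_mem' c _ hf := ⟨hf.1.const_smul c, fun x hx ↦ by rw [Pi.smul_apply, hf.2 x hx, smul_zero]⟩

namespace holFunOn

variable {W W' : Set M}

/-- Membership in `𝒪(W)`. [folklore] -/
theorem mem_iff {f : M → ℂ} :
    f ∈ holFunOn E W ↔ MDifferentiableOn 𝓘(ℂ, E) 𝓘(ℂ, ℂ) f W ∧ ∀ x ∉ W, f x = 0 :=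
  Iff.rfl

/-- An element of `𝒪(W)` is holomorphic on `W`. [folklore] -/
theorem mdifferentiableOn (f : holFunOn E W) : MDifferentiableOn 𝓘(ℂ, E) 𝓘(ℂ, ℂ) (f : M → ℂ) W :=
  f.2.1

/-- An element of `𝒪(W)` vanishes off `W`. [folklore] -/
theorem apply_of_notMem (f : holFunOn E W) {x : M} (hx : x ∉ W) : (f : M → ℂ) x = 0 :=
  f.2.2 x hx

/-- **Multiply by a function holomorphic on `W' ⊆ W` and restrict to `W'`**:
`f ↦ (g f)|_{W'}` (extended by zero), `𝒪(W) → 𝒪(W')` — the shape of the restriction maps of the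
sheaf of sections of a cocycle line bundle (`g` a transition function). [cite: VoisinHodgeI2002, Thm. 4.49 (proof)] -/
def mulRestrict (h : W' ⊆ W) {g : M → ℂ} (hg : MDifferentiableOn 𝓘(ℂ, E) 𝓘(ℂ, ℂ) g W') :
    holFunOn E W →ₗ[ℂ] holFunOn E W' where
  toFun f := ⟨W'.indicator fun x ↦ g x * (f : M → ℂ) x,
    (hg.mul ((mdifferentiableOn f).mono h)).congr fun x hx ↦ indicator_of_mem hx _,
    fun x hx ↦ indicator_of_notMem hx _⟩
  map_add' f f' := by
    refine Subtype.ext (funext fun x ↦ ?_)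
    by_cases hx : x ∈ W'
    · simp only [Submodule.coe_add, Pi.add_apply, indicator_of_mem hx, mul_add]
    · simp only [Submodule.coe_add, Pi.add_apply, indicator_of_notMem hx, add_zero]
  map_smul' c f := by
    refine Subtype.ext (funext fun x ↦ ?_)
    by_cases hx : x ∈ W'
    · simp only [Submodule.coe_smul, Pi.smul_apply, smul_eq_mul, indicator_of_mem hx,
        RingHom.id_apply]
      ring
    · simp only [Submodule.coe_smul, Pi.smul_apply, smul_eq_mul, indicator_of_notMem hx,
        RingHom.id_apply, mul_zero]

/-- `mulRestrict` at a point of `W'`. [folklore] -/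
theorem mulRestrict_apply_of_mem (h : W' ⊆ W) {g : M → ℂ}
    (hg : MDifferentiableOn 𝓘(ℂ, E) 𝓘(ℂ, ℂ) g W') (f : holFunOn E W) {x : M} (hx : x ∈ W') :
    (mulRestrict h hg f : M → ℂ) x = g x * (f : M → ℂ) x := by
  change W'.indicator (fun x ↦ g x * (f : M → ℂ) x) x = _
  exact indicator_of_mem hx _

/-- `mulRestrict` off `W'`. [folklore] -/
theorem mulRestrict_apply_of_notMem (h : W' ⊆ W) {g : M → ℂ}
    (hg : MDifferentiableOn 𝓘(ℂ, E) 𝓘(ℂ, ℂ) g W') (f : holFunOn E W) {x : M} (hx : x ∉ W') :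
    (mulRestrict h hg f : M → ℂ) x = 0 := by
  change W'.indicator (fun x ↦ g x * (f : M → ℂ) x) x = _
  exact indicator_of_notMem hx _

end holFunOn

namespace HolomorphicLineBundle

/-! ### Covers subordinate to the trivialisation, with frames -/

/-- **A framed cover for `L`**: an open family `V : κ → Set M` together with a frame index
`frame k` for every member, `V_k ⊆ U_{frame k}`, so that sections of `L` over subsets of `V_k` can
be written as functions in the frame `σ_{frame k}` (the covers `𝔙` finer than the trivialising
cover on which `C^•(𝔙, 𝒪(L))` is computed; Voisin I, §4.3.1). The family need not cover `M`.
[cite: VoisinHodgeI2002, §4.3.1] -/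
structure FramedCover (L : HolomorphicLineBundle ι E M) (κ : Type*) where
  /-- The members `V_k` of the family. [folklore] -/
  U : κ → Set M
  /-- The members are open. [folklore] -/
  isOpen : ∀ k, IsOpen (U k)
  /-- The frame index of each member. [folklore] -/
  frame : κ → ι
  /-- Each member lies in the trivialising set of its frame. [folklore] -/
  subset : ∀ k, U k ⊆ L.baseSet (frame k)

namespace FramedCover

variable {L : HolomorphicLineBundle ι E M} (C : L.FramedCover κ)

/-- A finite intersection `V_J` lies in the trivialising set of the frame of each of its indices.
[folklore] -/
theorem cechSet_subset_baseSet {n : ℕ} (J : Fin n → κ) (k : Fin n) :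
    cechSet C.U J ⊆ L.baseSet (C.frame (J k)) :=
  (cechSet_subset_apply C.U J k).trans (C.subset _)

/-- **The cochains `C^a(𝔙, 𝒪(L)) = Π_J 𝒪(L)(V_J)`** over all ordered `(a+1)`-tuples, the section
over `V_J` being written as a holomorphic function in the frame of the first index `J 0`.
[cite: SerreFAC1955, n° 18] -/
abbrev Cochain (a : ℕ) : Type _ :=
  ∀ J : Fin (a + 1) → κ, ↥(holFunOn E (cechSet C.U J))

/-- **The change of frame along a map of tuples** `τ : Fin (m+1) → Fin (n+1)`: the transition
function `g_{frame (J (τ 0)), frame (J 0)}` converting coordinates in the frame of the first index of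
the face `J ∘ τ` into coordinates in the frame of the first index of `J`.
[cite: VoisinHodgeI2002, Thm. 4.49 (proof)] -/
def trans {m n : ℕ} (J : Fin (n + 1) → κ) (τ : Fin (m + 1) → Fin (n + 1)) : M → ℂ :=
  L.coordChange (C.frame (J (τ 0))) (C.frame (J 0))

/-- The change of frame is holomorphic on `V_J`. [folklore] -/
theorem mdifferentiableOn_trans {m n : ℕ} (J : Fin (n + 1) → κ) (τ : Fin (m + 1) → Fin (n + 1)) :
    MDifferentiableOn 𝓘(ℂ, E) 𝓘(ℂ, ℂ) (C.trans J τ) (cechSet C.U J) :=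
  (L.mdifferentiableOn_coordChange _ _).mono fun _ hx ↦
    ⟨C.cechSet_subset_baseSet J (τ 0) hx, C.cechSet_subset_baseSet J 0 hx⟩

/-- **The change of frame is multiplicative** along composites of maps of tuples (the cocycle
condition `g_ij g_jk = g_ik` on `V_J ⊆ U_i ∩ U_j ∩ U_k`). [cite: VoisinHodgeI2002, §3.3.1] -/
theorem trans_mul_trans {l m n : ℕ} (J : Fin (n + 1) → κ) (τ : Fin (m + 1) → Fin (n + 1))
    (τ' : Fin (l + 1) → Fin (m + 1)) {x : M} (hx : x ∈ cechSet C.U J) :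
    C.trans J τ x * C.trans (J ∘ τ) τ' x = C.trans J (τ ∘ τ') x := by
  unfold trans
  rw [mul_comm]
  exact L.coordChange_comp _ _ _ x ⟨⟨C.cechSet_subset_baseSet J (τ (τ' 0)) hx,
    C.cechSet_subset_baseSet J (τ 0) hx⟩, C.cechSet_subset_baseSet J 0 hx⟩

/-- A map of tuples fixing the first index changes nothing: `g_ii = 1` on `V_J`. [folklore] -/
theorem trans_eq_one {m n : ℕ} (J : Fin (n + 1) → κ) {τ : Fin (m + 1) → Fin (n + 1)} (hτ : τ 0 = 0)
    {x : M} (hx : x ∈ cechSet C.U J) : C.trans J τ x = 1 := by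
  unfold trans
  rw [hτ]
  exact L.coordChange_self _ (C.cechSet_subset_baseSet J 0 hx)

/-- **The restriction map `𝒪(L)(V_{J ∘ τ}) → 𝒪(L)(V_J)` of the sheaf of sections** along a map of
tuples: restrict to `V_J ⊆ V_{J ∘ τ}` and convert to the frame of `J 0`.
[cite: VoisinHodgeI2002, Thm. 4.49 (proof)] -/
def face {m n : ℕ} (J : Fin (n + 1) → κ) (τ : Fin (m + 1) → Fin (n + 1)) :
    ↥(holFunOn E (cechSet C.U (J ∘ τ))) →ₗ[ℂ] ↥(holFunOn E (cechSet C.U J)) :=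
  holFunOn.mulRestrict (cechSet_subset_comp C.U J τ) (C.mdifferentiableOn_trans J τ)

/-- The restriction map at a point of `V_J`. [folklore] -/
theorem face_apply_of_mem {m n : ℕ} (J : Fin (n + 1) → κ) (τ : Fin (m + 1) → Fin (n + 1))
    (f : holFunOn E (cechSet C.U (J ∘ τ))) {x : M} (hx : x ∈ cechSet C.U J) :
    (C.face J τ f : M → ℂ) x = C.trans J τ x * (f : M → ℂ) x :=
  holFunOn.mulRestrict_apply_of_mem _ _ f hx

/-- The restriction map off `V_J`. [folklore] -/
theorem face_apply_of_notMem {m n : ℕ} (J : Fin (n + 1) → κ) (τ : Fin (m + 1) → Fin (n + 1))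
    (f : holFunOn E (cechSet C.U (J ∘ τ))) {x : M} (hx : x ∉ cechSet C.U J) :
    (C.face J τ f : M → ℂ) x = 0 :=
  holFunOn.mulRestrict_apply_of_notMem _ _ f hx

/-- **Functoriality of the restriction maps**: the sections of `L` over the finite intersections
form a presheaf on the nerve of `𝔙`. [cite: SerreFAC1955, n° 18] -/
theorem face_face {l m n : ℕ} (J : Fin (n + 1) → κ) (τ : Fin (m + 1) → Fin (n + 1))
    (τ' : Fin (l + 1) → Fin (m + 1)) (f : holFunOn E (cechSet C.U (J ∘ τ ∘ τ'))) :
    C.face J τ (C.face (J ∘ τ) τ' f) = C.face J (τ ∘ τ') f := by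
  refine Subtype.ext (funext fun x ↦ ?_)
  by_cases hx : x ∈ cechSet C.U J
  · rw [C.face_apply_of_mem J τ _ hx, C.face_apply_of_mem J (τ ∘ τ') _ hx,
      C.face_apply_of_mem (J ∘ τ) τ' _ (cechSet_subset_comp C.U J τ hx), ← mul_assoc,
      C.trans_mul_trans J τ τ' hx]
  · rw [C.face_apply_of_notMem J τ _ hx, C.face_apply_of_notMem J (τ ∘ τ') _ hx]

/-- A restriction map along a map of tuples fixing the first index is plain restriction.
[folklore] -/
theorem face_apply_of_mem_of_zero {m n : ℕ} (J : Fin (n + 1) → κ) {τ : Fin (m + 1) → Fin (n + 1)}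
    (hτ : τ 0 = 0) (f : holFunOn E (cechSet C.U (J ∘ τ))) {x : M} (hx : x ∈ cechSet C.U J) :
    (C.face J τ f : M → ℂ) x = (f : M → ℂ) x := by
  rw [C.face_apply_of_mem J τ f hx, C.trans_eq_one J hτ hx, one_mul]

/-! ### The Čech differential and `δ ∘ δ = 0` -/

/-- **The Čech differential of `C^•(𝔙, 𝒪(L))`**, `(δ c)_J = Σ_j (-1)^j c_{J ∘ σ_j}|_{V_J}`
(`σ_j = Fin.succAbove j`; the `0`-th face carries the change of frame
`g_{frame (J 1), frame (J 0)}`). [cite: SerreFAC1955, n° 18] -/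
def delta (a : ℕ) : C.Cochain a →ₗ[ℂ] C.Cochain (a + 1) where
  toFun c J := ∑ j : Fin (a + 2), (-1 : ℂ) ^ (j : ℕ) • C.face J (Fin.succAbove j) (c (J ∘ Fin.succAbove j))
  map_add' c c' := by
    funext J
    simp only [Pi.add_apply, map_add, smul_add, Finset.sum_add_distrib]
  map_smul' r c := by
    funext J
    simp only [Pi.smul_apply, map_smul, RingHom.id_apply, Finset.smul_sum, smul_smul, mul_comm r]

/-- The Čech differential, componentwise. [cite: SerreFAC1955, n° 18] -/
theorem delta_apply {a : ℕ} (c : C.Cochain a) (J : Fin (a + 2) → κ) :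
    C.delta a c J = ∑ j : Fin (a + 2), (-1 : ℂ) ^ (j : ℕ) •
      C.face J (Fin.succAbove j) (c (J ∘ Fin.succAbove j)) :=
  rfl

/-- The Čech differential at a point of `V_J`. [folklore] -/
theorem delta_apply_apply_of_mem {a : ℕ} (c : C.Cochain a) {J : Fin (a + 2) → κ} {x : M}
    (hx : x ∈ cechSet C.U J) :
    (C.delta a c J : M → ℂ) x = ∑ j : Fin (a + 2), (-1 : ℂ) ^ (j : ℕ) *
      (C.trans J (Fin.succAbove j) x * (c (J ∘ Fin.succAbove j) : M → ℂ) x) := by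
  rw [delta_apply, Submodule.coe_sum, Finset.sum_apply]
  refine Finset.sum_congr rfl fun j _ ↦ ?_
  rw [Submodule.coe_smul, Pi.smul_apply, smul_eq_mul, C.face_apply_of_mem J _ _ hx]

/-- **`δ ∘ δ = 0`** on `C^•(𝔙, 𝒪(L))` (functoriality of the restriction maps and the cancellation
of the double faces in pairs, `CechTuple.sum_sum_neg_one_pow_smul_smul_faces_eq_zero`).
[cite: SerreFAC1955, n° 18] -/
theorem delta_delta (a : ℕ) (c : C.Cochain a) : C.delta (a + 1) (C.delta a c) = 0 := by
  funext J
  rw [delta_apply, Pi.zero_apply]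
  simp only [delta_apply, map_sum, map_smul, face_face, Finset.smul_sum]
  exact CechTuple.sum_sum_neg_one_pow_smul_smul_faces_eq_zero (R := ℂ)
    (fun θ ↦ C.face J θ (c (J ∘ θ)))

/-- **The Čech cohomology `Ȟ^q(𝔙, 𝒪(L))`** of the framed cover with coefficients in the sheaf of
sections of `L`, in the tree's concrete format `NatCochain.Cohomology` (`ker δ^q / im δ^{q-1}`).
[cite: SerreFAC1955, n° 18] -/
def cohomology (q : ℕ) : Type _ :=
  NatCochain.Cohomology (R := ℂ) (fun a ↦ C.delta a) q

/-- The additive structure of `Ȟ^q(𝔙, 𝒪(L))`. [folklore] -/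
instance instAddCommGroupCohomology (q : ℕ) : AddCommGroup (C.cohomology q) :=
  inferInstanceAs (AddCommGroup (NatCochain.Cohomology (R := ℂ) (fun a ↦ C.delta a) q))

/-- The `ℂ`-module structure of `Ȟ^q(𝔙, 𝒪(L))`. [folklore] -/
instance instModuleCohomology (q : ℕ) : Module ℂ (C.cohomology q) :=
  inferInstanceAs (Module ℂ (NatCochain.Cohomology (R := ℂ) (fun a ↦ C.delta a) q))

/-! ### Degree `0`: cocycles are compatible families -/

/-- The Čech differential in degree `0` at a point of `V_k ∩ V_l`:
`(δ c)_{(k,l)} = g_{frame l, frame k} c_l - c_k`. [cite: SerreFAC1955, n° 18] -/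
theorem delta_zero_apply_apply (c : C.Cochain 0) (k l : κ) {x : M} (hx : x ∈ C.U k ∩ C.U l) :
    (C.delta 0 c ![k, l] : M → ℂ) x =
      L.coordChange (C.frame l) (C.frame k) x * (c ![l] : M → ℂ) x - (c ![k] : M → ℂ) x := by
  have hxJ : x ∈ cechSet C.U ![k, l] := by
    rw [mem_cechSet_iff, Fin.forall_fin_two]
    exact hx
  have e0 : (![k, l] : Fin 2 → κ) ∘ Fin.succAbove 0 = ![l] := by
    funext i; fin_cases i; rfl
  have e1 : (![k, l] : Fin 2 → κ) ∘ Fin.succAbove 1 = ![k] := by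
    funext i; fin_cases i; rfl
  have h0 : (c ((![k, l] : Fin 2 → κ) ∘ Fin.succAbove 0) : M → ℂ) x = (c ![l] : M → ℂ) x := by
    rw [e0]
  have h1 : (c ((![k, l] : Fin 2 → κ) ∘ Fin.succAbove 1) : M → ℂ) x = (c ![k] : M → ℂ) x := by
    rw [e1]
  have ht0 : C.trans ![k, l] (Fin.succAbove (0 : Fin 2)) x = L.coordChange (C.frame l) (C.frame k) x := by
    unfold trans
    simp
  have ht1 : C.trans ![k, l] (Fin.succAbove (1 : Fin 2)) x = 1 :=
    C.trans_eq_one _ (Fin.succAbove_ne_zero_zero one_ne_zero) hxJ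
  rw [C.delta_apply_apply_of_mem c hxJ, Fin.sum_univ_two]
  simp only [Fin.val_zero, pow_zero, one_mul, Fin.val_one, pow_one, h0, h1, ht0, ht1]
  ring

/-- **A `0`-cochain of `𝒪(L)` is a cocycle iff its components glue**: `δ c = 0` iff
`c_l = g_{frame k, frame l} c_k` on `V_k ∩ V_l` for all `k, l` — the components are the
coordinates, in the frames `σ_{frame k}`, of ONE section of `L` over `⋃_k V_k`, i.e.
`Ȟ⁰(𝔙, 𝒪(L)) = Γ(⋃ V_k, L)`. [cite: VoisinHodgeI2002, Thm. 4.49 (proof)] -/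
theorem delta_zero_eq_zero_iff (c : C.Cochain 0) :
    C.delta 0 c = 0 ↔ ∀ k l, ∀ x ∈ C.U k ∩ C.U l,
      (c ![l] : M → ℂ) x = L.coordChange (C.frame k) (C.frame l) x * (c ![k] : M → ℂ) x := by
  constructor
  · intro h k l x hx
    have hkl := congr_fun (congr_arg Subtype.val (congr_fun h ![l, k])) x
    rw [C.delta_zero_apply_apply c l k ⟨hx.2, hx.1⟩] at hkl
    exact (sub_eq_zero.1 hkl).symm
  · intro h
    funext J
    refine Subtype.ext (funext fun x ↦ ?_)
    have hJ : J = ![J 0, J 1] := by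
      funext i; fin_cases i <;> rfl
    by_cases hx : x ∈ cechSet C.U J
    · have hx' : x ∈ C.U (J 0) ∩ C.U (J 1) :=
        ⟨cechSet_subset_apply C.U J 0 hx, cechSet_subset_apply C.U J 1 hx⟩
      rw [hJ, C.delta_zero_apply_apply c (J 0) (J 1) hx', h (J 1) (J 0) x ⟨hx'.2, hx'.1⟩]
      exact sub_self _
    · rw [holFunOn.apply_of_notMem _ hx]
      rfl

/-! ### Shrinking the cover -/

/-- **Shrinking a framed cover** on the same index set and with the same frames (`V'_k ⊆ V_k`; the
nested covers `𝔙'' ≪ 𝔙' ≪ 𝔙` of the Cartan–Serre finiteness theorem). [cite: VoisinHodgeI2002, §4.3.1] -/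
def shrink (U' : κ → Set M) (hU' : ∀ k, IsOpen (U' k)) (h : ∀ k, U' k ⊆ C.U k) : L.FramedCover κ where
  U := U'
  isOpen := hU'
  frame := C.frame
  subset k := (h k).trans (C.subset k)

/-- **Restriction of cochains to a shrunk cover**, componentwise `c_J ↦ c_J|_{V'_J}`.
[cite: SerreFAC1955, n° 18] -/
def res (U' : κ → Set M) (hU' : ∀ k, IsOpen (U' k)) (h : ∀ k, U' k ⊆ C.U k) (a : ℕ) :
    C.Cochain a →ₗ[ℂ] (C.shrink U' hU' h).Cochain a where
  toFun c J := holFunOn.mulRestrict (cechSet_mono h J) (g := fun _ ↦ (1 : ℂ)) mdifferentiableOn_const (c J)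
  map_add' c c' := by
    funext J
    exact map_add (holFunOn.mulRestrict (cechSet_mono h J) (g := fun _ ↦ (1 : ℂ))
      mdifferentiableOn_const) (c J) (c' J)
  map_smul' r c := by
    funext J
    exact map_smul (holFunOn.mulRestrict (cechSet_mono h J) (g := fun _ ↦ (1 : ℂ))
      mdifferentiableOn_const) r (c J)

/-- Restriction at a point of `V'_J`. [folklore] -/
theorem res_apply_apply_of_mem (U' : κ → Set M) (hU' : ∀ k, IsOpen (U' k)) (h : ∀ k, U' k ⊆ C.U k)
    {a : ℕ} (c : C.Cochain a) {J : Fin (a + 1) → κ} {x : M} (hx : x ∈ cechSet U' J) :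
    (C.res U' hU' h a c J : M → ℂ) x = (c J : M → ℂ) x := by
  change (holFunOn.mulRestrict (cechSet_mono h J) (g := fun _ ↦ (1 : ℂ))
    mdifferentiableOn_const (c J) : M → ℂ) x = _
  rw [holFunOn.mulRestrict_apply_of_mem _ _ _ hx, one_mul]

/-- **Restriction is a cochain map**: `res ∘ δ = δ ∘ res`. [cite: SerreFAC1955, n° 18] -/
theorem res_delta (U' : κ → Set M) (hU' : ∀ k, IsOpen (U' k)) (h : ∀ k, U' k ⊆ C.U k) (a : ℕ)
    (c : C.Cochain a) :
    C.res U' hU' h (a + 1) (C.delta a c) = (C.shrink U' hU' h).delta a (C.res U' hU' h a c) := by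
  funext J
  refine Subtype.ext (funext fun x ↦ ?_)
  by_cases hx : x ∈ cechSet U' J
  · rw [C.res_apply_apply_of_mem U' hU' h _ hx,
      C.delta_apply_apply_of_mem c (cechSet_mono h J hx),
      (C.shrink U' hU' h).delta_apply_apply_of_mem _ hx]
    refine Finset.sum_congr rfl fun j _ ↦ ?_
    rw [C.res_apply_apply_of_mem U' hU' h _ (cechSet_subset_comp U' J _ hx)]
    rfl
  · rw [holFunOn.apply_of_notMem _ hx, holFunOn.apply_of_notMem _ hx]

end FramedCover

end HolomorphicLineBundle

end Literature.Geometry.Kaehler
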